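import Summits.PneNP.PneNP.Theorems.ChebyshevTracialDesignTransversalSquareSum
import Summits.PneNP.PneNP.Theorems.ChebyshevTracialDesignHalfDegreeDipole
import Summits.PneNP.PneNP.Theorems.ChebyshevTracialDesignInvolutionKeys
import HarnessLib

/-!
# Cell pnp-psdrank, route `ChebyshevTracialDesign`: the dipole HIT bound — level sums of a dipole product vanish
# unless every dipole is matched internally, and few perfect matchings do that (uniform-in-the-level attenuation)

Harmonic backbone of the `r = 1` rung of the crux `TracialDecayExp20` (stmt-PneNP-19878): eng g6's DIPOLE ROUTE to
the attenuation estimate (ATT) at EVERY level (MEMO-6 §2 (V)+(B)), kernel version. Data: `2κ` dipoles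
`a, b : Fin (2κ) → Fin n` (injective, disjoint ranges), dipole points `D = im a ∪ im b` (`|D| = 4κ`), the dipole product
`φ(U) = Π_i ([a_i ∈ U] − [b_i ∈ U])`, a perfect matching `M : PMatch n`, a cut size `t` and a crossing level `c`
(`#cr(U,M) = #{e ∈ M : cutCount U e = 1} = c`).
* §1 `exists_closed_subset`: if at least `2m` points of `D` are matched inside `D`, then `D` contains an `M`-closed
  `2m`-subset (keys of prover's `…InvolutionKeys`); `card_filter_allHit_le`: the matchings for which EVERY dipole has an
  endpoint matched inside `D` ("all dipoles hit") number at most `C(4κ,2κ) · pm(2κ) · pm(n−2κ)` (a hit matching closes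
  some `2κ`-subset of `D`; union bound with `card_filter_closed` of `…ClosedPairCount`).
* §2 `level_dipole_sum_eq_zero_of_not_allHit`: if some dipole is NOT hit, every level sum
  `Σ_{|U| = t, #cr(U,M) = c} φ(U)` vanishes (eng g6's involution `dipole_level_sum_eq_zero`, `…HalfDegreeDipole`).
* §3 `sum_sq_level_dipole_sum_le`: hence, if every level class has at most `B` cuts,
  `Σ_{M} (Σ_{|U| = t, #cr(U,M) = c} φ(U))² ≤ B² · C(4κ,2κ) · pm(2κ) · pm(n−2κ)` — UNIFORMLY IN THE LEVEL `c`. Divided by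
  `λ₀(c) = rowCount(c)·colCount(c)` (with `B = colCount(c)`) and by `‖φ‖² = 4^κ C(n−4κ, t−2κ)` this is eng g6's (B):
  `σ_{2κ}(c)² ≤ P_M[all dipoles hit]/E_U[φ²] ≤ [pm(n−2κ)/pm(n)]·C(4κ,2κ)(2κ−1)‼·C(n,t)/(4^κ C(n−4κ,t−2κ)) = (O(κ)/n)^κ`
  for balanced `t` — the shape (ATT) needs, with no representation theory and no `θ_k` sublemma; the constant is
  irrelevant for the crux (`∃ a > 0`). The conversion to lit's `kernelEigen` (via `kernelEigen_le_iff_dipole_gram`) is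
  left to the consumer, who owns the Gram class-function hypothesis of the level incidences.
[folklore] counting; perfect-matching scheme background [cite: GodsilMeagher2015, §15.2]; dipole products
[cite: Filmus2016, Def. 2.2 / Lemma 2.3 (arXiv pp. 4–5)].
WHAT THIS IS NOT: not (L2), not SNT, nothing on psd rank; the deep modes `κ ≳ n/17` are not improved by this bound.
Supports crux stmt-PneNP-19878.
-/

set_option linter.dupNamespace false -- `Summit.PneNP.PneNP.…`: summit = sub-problem (D-0017)

namespace Summit.PneNP.PneNP.Theorems.ChebyshevTracialDesignDipoleHitBound

open Finset Literature.Barriers.PneNP Literature.Combinatorics.SimpleGraph.CycleSpace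
open Summit.PneNP.PneNP.Theorems.ChebyshevTracialDesignClosedPairCount
open Summit.PneNP.PneNP.Theorems.ChebyshevTracialDesignTransversalSquareSum
open Summit.PneNP.PneNP.Theorems.ChebyshevTracialDesignInvolutionKeys
open Summit.PneNP.PneNP.Theorems.ChebyshevTracialDesignHalfDegree
open Summit.PneNP.PneNP.Theorems.ChebyshevTracialDesignJunta

variable {n : ℕ}

/-! ### §1 Closed subsets inside a set with many internally matched points; the hit count -/

/-- If at least `2m` points of `D` are matched (by `M`) inside `D`, then `D` contains an `M`-closed subset with
exactly `2m` points (take `m` keys among the internally matched points, with their partners). [folklore] -/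
theorem exists_closed_subset (M : PMatch n) (D : Finset (Fin n)) (m : ℕ)
    (hm : 2 * m ≤ (D.filter fun x => M.2.partner x ∈ D).card) :
    ∃ T ⊆ D, T.card = 2 * m ∧ ∀ x ∈ T, M.2.partner x ∈ T := by
  classical
  have hinv : ∀ x, M.2.partner (M.2.partner x) = x := M.2.partner_partner
  have hfix : ∀ x, M.2.partner x ≠ x := M.2.partner_ne
  have hH : ∀ x ∈ D.filter (fun x => M.2.partner x ∈ D), M.2.partner x ∈ D.filter (fun x => M.2.partner x ∈ D) := by
    intro x hx
    rw [mem_filter] at hx ⊢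
    exact ⟨hx.2, by rw [hinv]; exact hx.1⟩
  have hcard := card_closed_eq_two_mul hinv hfix hH
  have hKm : m ≤ ((D.filter fun x => M.2.partner x ∈ D).filter fun x => x < M.2.partner x).card := by omega
  obtain ⟨K', hK'K, hK'card⟩ := exists_subset_card_eq hKm
  have hK' : ∀ x ∈ K', x < M.2.partner x := fun x hx => (mem_filter.1 (hK'K hx)).2
  obtain ⟨hclosed, -, hcard2⟩ := union_image_props hinv hK'
  refine ⟨K' ∪ K'.image M.2.partner, ?_, by rw [hcard2, hK'card], hclosed⟩
  intro x hx
  rcases mem_union.1 hx with h | h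
  · exact (mem_filter.1 (mem_filter.1 (hK'K h)).1).1
  · obtain ⟨y, hy, rfl⟩ := mem_image.1 h
    exact (mem_filter.1 (mem_filter.1 (hK'K hy)).1).2

variable {κ : ℕ} {a b : Fin (2 * κ) → Fin n}

/-- **All dipoles hit ⇒ a closed `2κ`-subset of the dipole points.** If every one of the `2κ` dipoles `{a_i, b_i}`
has an endpoint matched inside the dipole points `D`, then `D` (`|D| = 4κ`) contains an `M`-closed `2κ`-subset.
[folklore] -/
theorem exists_closed_subset_of_allHit (ha : Function.Injective a) (hb : Function.Injective b)
    (hab : ∀ i j, a i ≠ b j) (M : PMatch n)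
    (hhit : ∀ i, M.2.partner (a i) ∈ univ.image a ∪ univ.image b ∨ M.2.partner (b i) ∈ univ.image a ∪ univ.image b) :
    ∃ T ⊆ univ.image a ∪ univ.image b, T.card = 2 * κ ∧ ∀ x ∈ T, M.2.partner x ∈ T := by
  classical
  refine exists_closed_subset M _ κ ?_
  -- one internally matched endpoint per dipole: the section picking `a i` when its partner lies in `D`
  set D := univ.image a ∪ univ.image b with hD
  set S : Finset (Fin (2 * κ)) := univ.filter fun i => M.2.partner (a i) ∈ D with hS
  have hsub : (univ.image fun i => if i ∈ S then a i else b i) ⊆ D.filter fun x => M.2.partner x ∈ D := by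
    intro x hx
    obtain ⟨i, -, rfl⟩ := mem_image.1 hx
    rw [mem_filter]
    by_cases hi : i ∈ S
    · rw [if_pos hi]
      exact ⟨mem_union.2 (Or.inl (mem_image_of_mem a (mem_univ i))), (mem_filter.1 hi).2⟩
    · rw [if_neg hi]
      refine ⟨mem_union.2 (Or.inr (mem_image_of_mem b (mem_univ i))), ?_⟩
      rcases hhit i with h | h
      · exact absurd (mem_filter.2 ⟨mem_univ i, h⟩) hi
      · exact h
  have := card_le_card hsub
  rw [card_transversal ha hb hab] at this
  omega

/-- The dipole point set has `4κ` points. [folklore] -/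
theorem card_dipolePoints (ha : Function.Injective a) (hb : Function.Injective b) (hab : ∀ i j, a i ≠ b j) :
    (univ.image a ∪ univ.image b).card = 4 * κ := by
  classical
  rw [card_union_of_disjoint, card_image_of_injective _ ha, card_image_of_injective _ hb, card_univ, Fintype.card_fin]
  · ring
  · rw [disjoint_left]
    intro x hxa hxb
    obtain ⟨i, -, rfl⟩ := mem_image.1 hxa
    obtain ⟨j, -, hj⟩ := mem_image.1 hxb
    exact hab i j hj.symm

/-- **The hit count.** The perfect matchings of `K_n` for which every dipole has an endpoint matched inside the
dipole points number at most `C(4κ, 2κ) · pm(2κ) · pm(n − 2κ)`. [folklore] -/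
theorem card_filter_allHit_le (ha : Function.Injective a) (hb : Function.Injective b) (hab : ∀ i j, a i ≠ b j) :
    (univ.filter fun M : PMatch n => ∀ i, M.2.partner (a i) ∈ univ.image a ∪ univ.image b ∨
        M.2.partner (b i) ∈ univ.image a ∪ univ.image b).card ≤
      (4 * κ).choose (2 * κ) * pmCount (2 * κ) * pmCount (n - 2 * κ) := by
  classical
  set D := univ.image a ∪ univ.image b with hD
  have hDcard : D.card = 4 * κ := card_dipolePoints ha hb hab
  have hsub : (univ.filter fun M : PMatch n => ∀ i, M.2.partner (a i) ∈ D ∨ M.2.partner (b i) ∈ D) ⊆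
      (D.powersetCard (2 * κ)).biUnion fun T => univ.filter fun M : PMatch n => ∀ x ∈ T, M.2.partner x ∈ T := by
    intro M hM
    rw [mem_filter] at hM
    obtain ⟨T, hTD, hTcard, hTcl⟩ := exists_closed_subset_of_allHit ha hb hab M hM.2
    rw [mem_biUnion]
    exact ⟨T, mem_powersetCard.2 ⟨hTD, hTcard⟩, mem_filter.2 ⟨mem_univ _, hTcl⟩⟩
  refine (card_le_card hsub).trans ((card_biUnion_le).trans ?_)
  have hterm : ∀ T ∈ D.powersetCard (2 * κ),
      (univ.filter fun M : PMatch n => ∀ x ∈ T, M.2.partner x ∈ T).card = pmCount (2 * κ) * pmCount (n - 2 * κ) := by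
    intro T hT
    rw [mem_powersetCard] at hT
    rw [card_filter_closed, hT.2, card_compl, Fintype.card_fin, hT.2]
  rw [sum_congr rfl hterm, sum_const, card_powersetCard, hDcard, smul_eq_mul, mul_assoc]

/-! ### §2 Level sums of the dipole product vanish unless all dipoles are hit -/

/-- **Dipole vanishing on the `t`-slice level classes.** If some dipole `{a_{i₀}, b_{i₀}}` has BOTH partners outside the
dipole points, then for every cut size `t` and level `c`, `Σ_{|U| = t, #cr(U,M) = c} Π_i ([a_i ∈ U] − [b_i ∈ U]) = 0`
(eng g6's involution `(a b)(p q)`, `…HalfDegreeDipole.dipole_level_sum_eq_zero`, restricted to the slice via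
`|U| = #cr + 2·#in`). [folklore] -/
theorem level_dipole_sum_eq_zero_of_not_allHit (ha : Function.Injective a) (hb : Function.Injective b)
    (hab : ∀ i j, a i ≠ b j) (M : PMatch n) {i₀ : Fin (2 * κ)}
    (ha₀ : M.2.partner (a i₀) ∉ univ.image a ∪ univ.image b) (hb₀ : M.2.partner (b i₀) ∉ univ.image a ∪ univ.image b)
    (t c : ℕ) :
    ∑ U ∈ (univ.powersetCard t).filter (fun U : Finset (Fin n) => (M.1.filter fun e => cutCount U e = 1).card = c),
      ∏ i, ((if a i ∈ U then (1 : ℝ) else 0) - (if b i ∈ U then (1 : ℝ) else 0)) = 0 := by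
  classical
  set p := M.2.partner (a i₀) with hp
  set q := M.2.partner (b i₀) with hq
  have hinv : ∀ x, M.2.partner (M.2.partner x) = x := M.2.partner_partner
  -- the hypotheses of eng g6's involution lemma
  have hap : s(a i₀, p) ∈ M.1 := M.2.mk_partner_mem _
  have hbq : s(b i₀, q) ∈ M.1 := M.2.mk_partner_mem _
  have memDa : ∀ i, a i ∈ univ.image a ∪ univ.image b := fun i => mem_union.2 (Or.inl (mem_image_of_mem a (mem_univ i)))
  have memDb : ∀ i, b i ∈ univ.image a ∪ univ.image b := fun i => mem_union.2 (Or.inr (mem_image_of_mem b (mem_univ i)))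
  have hpq : p ≠ q := by
    intro h
    apply hab i₀ i₀
    have := congrArg M.2.partner h
    rwa [hp, hq, hinv, hinv] at this
  have haq : a i₀ ≠ q := fun h => hb₀ (h ▸ memDa i₀)
  have hbp : b i₀ ≠ p := fun h => ha₀ (h ▸ memDb i₀)
  have hfix : ∀ i ∈ (univ : Finset (Fin (2 * κ))), i ≠ i₀ → a i ≠ a i₀ ∧ a i ≠ b i₀ ∧ a i ≠ p ∧ a i ≠ q ∧
      b i ≠ a i₀ ∧ b i ≠ b i₀ ∧ b i ≠ p ∧ b i ≠ q := by
    intro i _ hi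
    refine ⟨fun h => hi (ha h), hab i i₀, fun h => ha₀ (h ▸ memDa i), fun h => hb₀ (h ▸ memDa i),
      fun h => hab i₀ i h.symm, fun h => hi (hb h), fun h => ha₀ (h ▸ memDb i), fun h => hb₀ (h ▸ memDb i)⟩
  -- the slice class is one of eng g6's (#cr, #in) classes, or empty
  by_cases hct : c ≤ t ∧ Even (t - c)
  · obtain ⟨hle, j, hj⟩ := hct
    have hfilt : (univ.powersetCard t).filter (fun U : Finset (Fin n) => (M.1.filter fun e => cutCount U e = 1).card = c) =
        (univ : Finset (Fin n)).powerset.filter (fun U => (M.1.filter fun e => cutCount U e = 1).card = c ∧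
          (M.1.filter fun e => cutCount U e = 2).card = j) := by
      ext U
      simp only [mem_filter, mem_powersetCard, mem_powerset, subset_univ, true_and]
      have hU := card_eq_cr_add_two_mul_in M.2 (subset_univ U)
      constructor
      · rintro ⟨hUt, hc⟩
        refine ⟨hc, ?_⟩
        omega
      · rintro ⟨hc, hj'⟩
        refine ⟨?_, hc⟩
        omega
    rw [hfilt]
    exact dipole_level_sum_eq_zero M.2 univ a b (mem_univ i₀) hap hbq (hab i₀ i₀) hpq haq hbp hfix c j
  · -- empty class
    have hfilt : (univ.powersetCard t).filter (fun U : Finset (Fin n) => (M.1.filter fun e => cutCount U e = 1).card = c) = ∅ := by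
      rw [filter_eq_empty_iff]
      intro U hU hc
      rw [mem_powersetCard] at hU
      have hU' := card_eq_cr_add_two_mul_in M.2 (subset_univ U)
      apply hct
      refine ⟨by omega, ⟨(M.1.filter fun e => cutCount U e = 2).card, by omega⟩⟩
    rw [hfilt, sum_empty]

/-! ### §3 The uniform-in-the-level square-sum bound -/

/-- **Dipole hit bound (uniform in the level).** For `2κ` dipoles with injective, disjoint `a, b`, every cut size `t`
and every crossing level `c`: if each level class `{U : |U| = t, #cr(U,M) = c}` has at most `B` elements, then
`Σ_{M} (Σ_{|U| = t, #cr(U,M) = c} Π_i ([a_i ∈ U] − [b_i ∈ U]))² ≤ B² · C(4κ,2κ) · pm(2κ) · pm(n−2κ)`.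
[folklore] -/
theorem sum_sq_level_dipole_sum_le (ha : Function.Injective a) (hb : Function.Injective b) (hab : ∀ i j, a i ≠ b j)
    (t c : ℕ) {B : ℝ}
    (hB : ∀ M : PMatch n,
      (((univ.powersetCard t).filter (fun U : Finset (Fin n) => (M.1.filter fun e => cutCount U e = 1).card = c)).card : ℝ) ≤ B) :
    ∑ M : PMatch n, (∑ U ∈ (univ.powersetCard t).filter
        (fun U : Finset (Fin n) => (M.1.filter fun e => cutCount U e = 1).card = c),
          ∏ i, ((if a i ∈ U then (1 : ℝ) else 0) - (if b i ∈ U then (1 : ℝ) else 0))) ^ 2 ≤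
      B ^ 2 * (((4 * κ).choose (2 * κ) * pmCount (2 * κ) * pmCount (n - 2 * κ) : ℕ) : ℝ) := by
  classical
  set D := univ.image a ∪ univ.image b with hD
  set N : ℕ := (4 * κ).choose (2 * κ) * pmCount (2 * κ) * pmCount (n - 2 * κ) with hN
  -- each term: `≤ B²` if all dipoles are hit, `0` otherwise
  have key : ∀ M : PMatch n,
      (∑ U ∈ (univ.powersetCard t).filter
          (fun U : Finset (Fin n) => (M.1.filter fun e => cutCount U e = 1).card = c),
            ∏ i, ((if a i ∈ U then (1 : ℝ) else 0) - (if b i ∈ U then (1 : ℝ) else 0))) ^ 2 ≤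
        B ^ 2 * (if (∀ i, M.2.partner (a i) ∈ D ∨ M.2.partner (b i) ∈ D) then 1 else 0) := by
    intro M
    by_cases hhit : ∀ i, M.2.partner (a i) ∈ D ∨ M.2.partner (b i) ∈ D
    · rw [if_pos hhit, mul_one]
      set F := (univ.powersetCard t).filter
          (fun U : Finset (Fin n) => (M.1.filter fun e => cutCount U e = 1).card = c) with hF
      have h1 : ∀ U ∈ F, |∏ i, ((if a i ∈ U then (1 : ℝ) else 0) - (if b i ∈ U then (1 : ℝ) else 0))| ≤ 1 := by
        intro U _
        rw [abs_prod]
        refine prod_le_one (fun i _ => abs_nonneg _) fun i _ => ?_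
        by_cases h1 : a i ∈ U <;> by_cases h2 : b i ∈ U <;> simp [h1, h2]
      have habs : |∑ U ∈ F, ∏ i, ((if a i ∈ U then (1 : ℝ) else 0) - (if b i ∈ U then (1 : ℝ) else 0))| ≤ B :=
        calc |∑ U ∈ F, ∏ i, ((if a i ∈ U then (1 : ℝ) else 0) - (if b i ∈ U then (1 : ℝ) else 0))|
            ≤ ∑ U ∈ F, |∏ i, ((if a i ∈ U then (1 : ℝ) else 0) - (if b i ∈ U then (1 : ℝ) else 0))| :=
              abs_sum_le_sum_abs _ _
          _ ≤ ∑ U ∈ F, (1 : ℝ) := sum_le_sum h1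
          _ = F.card := by rw [sum_const, nsmul_eq_mul, mul_one]
          _ ≤ B := hB M
      have h0 : 0 ≤ B := (abs_nonneg _).trans habs
      rw [← sq_abs]
      exact pow_le_pow_left₀ (abs_nonneg _) habs 2
    · rw [if_neg hhit, mul_zero]
      push Not at hhit
      obtain ⟨i₀, ha₀, hb₀⟩ := hhit
      rw [level_dipole_sum_eq_zero_of_not_allHit ha hb hab M ha₀ hb₀ t c]
      simp
  refine (sum_le_sum fun M _ => key M).trans ?_
  rw [← mul_sum, sum_boole]
  refine mul_le_mul_of_nonneg_left ?_ (sq_nonneg B)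
  exact_mod_cast card_filter_allHit_le (n := n) ha hb hab

end Summit.PneNP.PneNP.Theorems.ChebyshevTracialDesignDipoleHitBound
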